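import Literature.IUT.HodgeArakelov.GoodPrimeFrobenioidMonoidsProofs
import Literature.IUT.HodgeArakelov.GaussianMonoidsGood
import Literature.AnabelianGeometry.AbsoluteAnabelian.MonoidKummerMapsProofs
import Literature.AnabelianGeometry.AbsoluteAnabelian.MonoidKummerMapsUnitPairProofs
import Literature.AnabelianGeometry.AbsoluteAnabelian.MonoidKummerMapsTCGTorsorProofs
import Literature.AnabelianGeometry.AbsoluteAnabelian.MLFGaloisModelPairs
import HarnessLib

/-!
# [IUTchII] Prop 4.2 (i), (ii) [unit part], (iii) [indeterminacy] at good nonarchimedean primes —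
# BRIDGE to [AbsTopIII] §3 pairs (REAL statements of the slots of `Prop42Statements`, with proofs)

S. Mochizuki, *Inter-universal Teichmüller theory II*, §4, kurims manuscript (Dec. 2020), Proposition 4.2
(i)–(iii) pp. 123–125 (`v ∈ V^good ∩ V^non`), read on the page (lit key `paper:url-5036b4059555`,
pp. 120–126) [cite: Mochizuki2012, Prop 4.2 p.123]. Companion file `GoodPrimeKummerBridgeTheta.lean`: the
label and theta/Gaussian clauses (iii), (iv) of Prop 4.2 / 4.4.
Claim key DISPUTED (D-0012). Printed proof (p. 125): "The various assertions of Proposition 4.2 follow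
immediately from the definitions and the references quoted in the statements of these assertions."

WHY THIS FILE. The statement file `GoodPrimeFrobenioidMonoids.lean` (abc-iut-L6-t2, p404158) records the
sub-items (i), (ii)-unit part, (iii), (iv) of Prop 4.2 / 4.4 as BARE `Prop` FIELDS of the interfaces
`Prop42Statements` / `Prop44Statements` (slots with nothing to inhabit; DISCHARGE-L6 §E2 LIST B1 "SLOT ×6",
§F row F9). The references the print quotes are now typed: [AbsTopIII] Def 3.1 / Prop 3.2 (iv) / Prop 3.3
(ii) = abc-iut-L4-t2's `GaloisMonoidPair`, `IsMLFGaloisMonoidPair`, `PairIsoDeterminedByGalois` (PROVED: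
`pairIsoDeterminedByGalois_holds`), `GaloisIsoLiftsToTMPairIso`, `GaloisIsoLiftsToTMPairIsoOfMonoAnalytic`
(= [IUTchII] Rmk 1.11.1 (i)(a)), `unitPairIso_isoM_eq` (PROVED), `GaloisMonoidPair.Iso.tcg_exists_realising`
(PROVED, abc-iut-L6-d1), `TCGPairIsoLiftsOfMonoAnalytic` (= Rmk 1.11.1 (i)(b)). This file states the slots (i) and (ii)-unit part as REAL propositions over that
vocabulary and proves them — unconditionally where the print's reference is
proved in the tree, and otherwise from the quoted [AbsTopIII]/[IUTchII] lifting statement BY NAME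
(FACT-LIST F-0409/F-0410/F-0411; no new `Prop` fact is introduced).

WHAT THE KERNEL IS MADE TO SAY.
* (i) p. 124 "There exists a unique `G_v(†Π_v)`-equivariant isomorphism of monoids […]
  `Ψ_{†F_v} ⥲ Ψ_cns(†Π_v)` — cf. Remark 1.11.1, (i), (a); [AbsTopIII], Proposition 3.2, (iv)": for two
  MLF-Galois `TM`-pairs
  `(Π ↷ M)`, `(Π* ↷ M*)` and an identification `f : Π ⥲ Π*` of their topological groups, the set of
  `f`-equivariant monoid isomorphisms `M ⥲ M*` (`equivariantIsoOver`) has AT MOST ONE element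
  (`equivariantIsoOver_subsingleton`, from `pairIsoDeterminedByGalois_holds` — unconditional) and EXACTLY
  ONE (`Prop42i`) as soon as `f` lifts — from `GaloisIsoLiftsToTMPairIsoOfMonoAnalytic` for pairs of
  mono-analytic type (the shape of Rmk 1.11.1 (i)(a): both monoids acted on by `G_v(†Π_v)`,
  `prop42i_of_monoAnalyticLifts`) or from `GaloisIsoLiftsToTMPairIso H` for pairs "of hyperbolic
  orbicurve type" `H` with the same arithmetic quotient (`prop42i_of_galoisIsoLifts`).
* (ii) p. 124, unit part "There exists a unique `†G_v`-equivariant `Ẑ^×`-orbit of isomorphisms of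
  topological groups `Ψ^×_{†F^⊢_v} ⥲ Ψ_cns(†G_v)^×` — cf. Remark 1.11.1, (i), (b); [AbsTopIII], Proposition
  3.3, (ii)": in
  abc-iut-L4-t2's typing the `Ẑ^×`-indeterminacy of an isomorphism of `TCG`-pairs IS its cyclotome
  component (`UnitPairIsoFibres`: an isomorphism of pairs is determined by its Galois component and its
  action `μ_Ẑ(M) ⥲ μ_Ẑ(M*)`; `Aut(μ_Ẑ) = Ẑ^×`), so "a unique `Ẑ^×`-orbit of `f`-equivariant isomorphisms"
  reads: for every isomorphism of cyclotomes `u` there is EXACTLY ONE `f`-equivariant group isomorphism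
  inducing `u` (`Prop42iiUnit`). PROVED: uniqueness (`equivariantIsoOver_eq_of_cyclotome_eq`, from
  `unitPairIso_isoM_eq`) and FULLNESS of the orbit (`prop42iiUnit_of_exists`: ONE `f`-equivariant isomorphism
  yields the whole `Ẑ^×`-torsor, from abc-iut-L6-d1's `GaloisMonoidPair.Iso.tcg_exists_realising`); the
  existence of one lift enters from `TCGPairIsoLiftsOfMonoAnalytic` BY NAME (`prop42iiUnit_of_tcgLifts`).
  (The realified part of (ii) is `PointedHalfLine.isoUnique_holds`, p404684.)
* (iii) p. 124 "which are well-defined up to composition with an inner automorphism of `†Π_v` which is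
  independent of `t ∈ LabCusp^±(†Π_v)`": PROVED — conjugating the identification `f` by `γ ∈ Π` translates the `f`-equivariant
  isomorphisms by `γ` (`equivariantIsoOver_conj`); the labeled families, diagonals and theta/Gaussian
  monoids of (iii)/(iv) are in the companion file `GoodPrimeKummerBridgeTheta.lean`.

HONEST FRAMING. Interface-level bridge + elementary algebra; the [AbsTopIII] lifting statements enter BY
NAME where print cites them; nothing here bears on [IUTchIII] Cor. 3.12 or takes a side. Topologies on the
monoids are suppressed exactly as in [AbsTopIII] Rmk 3.1.1 / abc-iut-L4-t2's pairs ("isomorphisms of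
topological groups" = isomorphisms of the underlying groups). typed ≠ discharged elsewhere.
-/

namespace Literature.IUT.HodgeArakelov

open Literature.AnabelianGeometry.AbsoluteAnabelian
open scoped NNReal

universe u

namespace GoodPrimeKummer

/-! ### 1. Equivariant isomorphisms over an identification of topological groups -/

section Equivariant

variable {P Q : GaloisMonoidPair.{u}}

/-- The set of isomorphisms of monoids `M ⥲ M*` between the objects of two pairs `(Π ↷ M)`, `(Π* ↷ M*)`
that are EQUIVARIANT along a given identification `f : Π ⥲ Π*` — for `f` "the identity of `G_v(†Π_v)`"
these are the "`G_v(†Π_v)`-equivariant isomorphism[s] of monoids `Ψ_{†F_v} ⥲ Ψ_cns(†Π_v)`" of [IUTchII]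
Prop 4.2 (i) p. 124. [cite: Mochizuki2012, Prop 4.2 (i) p.124] -/
def equivariantIsoOver (P Q : GaloisMonoidPair.{u}) (f : P.Pi ≃ₜ* Q.Pi) : Set (P.M ≃* Q.M) :=
  {φ | ∀ (g : P.Pi) (m : P.M), φ (g • m) = f g • φ m}

/-- Membership in `equivariantIsoOver`. [cite: Mochizuki2012, Prop 4.2 (i) p.124] -/
theorem mem_equivariantIsoOver {f : P.Pi ≃ₜ* Q.Pi} {φ : P.M ≃* Q.M} :
    φ ∈ equivariantIsoOver P Q f ↔ ∀ (g : P.Pi) (m : P.M), φ (g • m) = f g • φ m := Iff.rfl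

/-- An `f`-equivariant isomorphism IS an isomorphism of [AbsTopIII] Def 3.1 (ii) pairs with Galois
component `f` (abc-iut-L4-t2's `GaloisMonoidPair.Iso`). [cite: MochizukiAbsTopIII2015, Definition 3.1 (ii) p.67] -/
def isoOfEquivariant (f : P.Pi ≃ₜ* Q.Pi) (φ : P.M ≃* Q.M) (hφ : φ ∈ equivariantIsoOver P Q f) :
    GaloisMonoidPair.Iso P Q where
  isoPi := f
  isoM := φ
  smul_comm := hφ

/-- The monoid component of an isomorphism of pairs is equivariant along its Galois component.
[cite: MochizukiAbsTopIII2015, Definition 3.1 (ii) p.67] -/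
theorem isoM_mem_equivariantIsoOver (e : GaloisMonoidPair.Iso P Q) :
    e.isoM ∈ equivariantIsoOver P Q e.isoPi := e.smul_comm

/-- `φ` is `f`-equivariant iff `(f, φ)` is an isomorphism of pairs. [cite: MochizukiAbsTopIII2015, Definition 3.1 (ii) p.67] -/
theorem mem_equivariantIsoOver_iff_exists_iso {f : P.Pi ≃ₜ* Q.Pi} {φ : P.M ≃* Q.M} :
    φ ∈ equivariantIsoOver P Q f ↔ ∃ e : GaloisMonoidPair.Iso P Q, e.isoPi = f ∧ e.isoM = φ :=
  ⟨fun h => ⟨isoOfEquivariant f φ h, rfl, rfl⟩, by rintro ⟨e, rfl, rfl⟩; exact e.smul_comm⟩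

/-- The identity is equivariant over the identity identification. [cite: Mochizuki2012, Prop 4.2 (i) p.124] -/
theorem refl_mem_equivariantIsoOver (P : GaloisMonoidPair.{u}) :
    MulEquiv.refl P.M ∈ equivariantIsoOver P P (ContinuousMulEquiv.refl P.Pi) := fun _ _ => rfl

/-- Inverses: an `f`-equivariant isomorphism has an `f⁻¹`-equivariant inverse. [cite: Mochizuki2012, Prop 4.2 (i) p.124] -/
theorem symm_mem_equivariantIsoOver {f : P.Pi ≃ₜ* Q.Pi} {φ : P.M ≃* Q.M}
    (hφ : φ ∈ equivariantIsoOver P Q f) : φ.symm ∈ equivariantIsoOver Q P f.symm := by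
  intro h y
  apply φ.injective
  rw [MulEquiv.apply_symm_apply, hφ, MulEquiv.apply_symm_apply, ContinuousMulEquiv.apply_symm_apply]

/-- Composition: equivariant isomorphisms compose over the composite identification.
[cite: Mochizuki2012, Prop 4.2 (i) p.124] -/
theorem trans_mem_equivariantIsoOver {R : GaloisMonoidPair.{u}} {f : P.Pi ≃ₜ* Q.Pi} {f' : Q.Pi ≃ₜ* R.Pi}
    {φ : P.M ≃* Q.M} {ψ : Q.M ≃* R.M} (hφ : φ ∈ equivariantIsoOver P Q f)
    (hψ : ψ ∈ equivariantIsoOver Q R f') : φ.trans ψ ∈ equivariantIsoOver P R (f.trans f') := by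
  intro g m
  change ψ (φ (g • m)) = f' (f g) • ψ (φ m)
  rw [hφ, hψ]

/-- **Inner-automorphism indeterminacy** ([IUTchII] Prop 4.2 preamble p. 123 "determined, up to inner
automorphism [i.e., up to an automorphism arising from an element of `†Π_v`], by `†F_v`"; Prop 4.2 (iii)
p. 124 "which are well-defined up to composition with an inner automorphism of `†Π_v` which is independent
of `t ∈ LabCusp^±(†Π_v)`"):
replacing the identification `f` by `f ∘ conj(γ)` (any `f'` with `f' g = f (γ g γ⁻¹)`) replaces an
`f`-equivariant isomorphism `φ` by `m ↦ φ (γ • m)`. [cite: Mochizuki2012, Prop 4.2 (iii) p.124] -/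
theorem equivariantIsoOver_conj {f : P.Pi ≃ₜ* Q.Pi} {φ : P.M ≃* Q.M} (hφ : φ ∈ equivariantIsoOver P Q f)
    (γ : P.Pi) (f' : P.Pi ≃ₜ* Q.Pi) (hf' : ∀ g, f' g = f (γ * g * γ⁻¹)) :
    (MulDistribMulAction.toMulEquiv P.M γ).trans φ ∈ equivariantIsoOver P Q f' := by
  intro g m
  change φ (γ • (g • m)) = f' g • φ (γ • m)
  rw [hf', ← hφ, smul_smul, smul_smul, inv_mul_cancel_right]

end Equivariant

/-! ### 2. Prop 4.2 (i): the constant monoids — a unique equivariant isomorphism of `TM`-pairs -/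

section ConstantMonoids

variable {P Q : GaloisMonoidPair.{0}}

/-- **Uniqueness half of [IUTchII] Prop 4.2 (i)**, PROVED: between MLF-Galois `TM`-pairs there is AT MOST
ONE `f`-equivariant isomorphism of monoids over any identification `f` of the groups — the injectivity
clause of [AbsTopIII] Prop 3.2 (iv) (abc-iut-L4-t2's `PairIsoDeterminedByGalois`, PROVED in the tree as
`pairIsoDeterminedByGalois_holds`). [cite: Mochizuki2012, Prop 4.2 (i) p.124] -/
theorem equivariantIsoOver_subsingleton (hP : IsMLFGaloisMonoidPair .TM P) (hQ : IsMLFGaloisMonoidPair .TM Q)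
    (f : P.Pi ≃ₜ* Q.Pi) {φ₁ φ₂ : P.M ≃* Q.M} (h₁ : φ₁ ∈ equivariantIsoOver P Q f)
    (h₂ : φ₂ ∈ equivariantIsoOver P Q f) : φ₁ = φ₂ :=
  pairIsoDeterminedByGalois_holds P Q hP hQ (isoOfEquivariant f φ₁ h₁) (isoOfEquivariant f φ₂ h₂) rfl

/-- **REAL STATEMENT of [IUTchII] Prop 4.2 (i)** (p. 124: "There exists a unique `G_v(†Π_v)`-equivariant
isomorphism of monoids […] `Ψ_{†F_v} ⥲ Ψ_cns(†Π_v)`"; [IUTchII] Prop 4.4 (i) p. 129 prints the archimedean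
analogue) for the pair `P = (G_v(†Π_v) ↷ Ψ_{†F_v})` determined by the `p_v`-adic Frobenioid `†F_v`
([IUTchI] Def 5.2 (vi) "`‡M_v`"), the group-theoretic pair `Q = (G_v(†Π_v) ↷ Ψ_cns(†Π_v))` of Prop 4.1 (i),
and the identification `f` of the acting groups: exactly one `f`-equivariant isomorphism of monoids. The
slot it makes real: `Prop42Statements.constantKummer` / `Prop44Statements.constantKummer` (p404158).
[cite: Mochizuki2012, Prop 4.2 (i) p.124] -/
def Prop42i (P Q : GaloisMonoidPair.{u}) (f : P.Pi ≃ₜ* Q.Pi) : Prop :=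
  ∃! φ : P.M ≃* Q.M, φ ∈ equivariantIsoOver P Q f

/-- `Prop42i` from uniqueness + any lift of `f` to an isomorphism of pairs. [cite: Mochizuki2012, Prop 4.2 (i) p.124] -/
theorem prop42i_of_exists_lift (hP : IsMLFGaloisMonoidPair .TM P) (hQ : IsMLFGaloisMonoidPair .TM Q)
    (f : P.Pi ≃ₜ* Q.Pi) (h : ∃ e : GaloisMonoidPair.Iso P Q, e.isoPi = f) : Prop42i P Q f := by
  obtain ⟨e, rfl⟩ := h
  exact ⟨e.isoM, isoM_mem_equivariantIsoOver e,
    fun φ hφ => equivariantIsoOver_subsingleton hP hQ e.isoPi hφ (isoM_mem_equivariantIsoOver e)⟩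

/-- **[IUTchII] Prop 4.2 (i) DISCHARGED in the shape of its first reference, Rmk 1.11.1 (i)(a)** (pp. 49–50:
"the group of automorphisms of the underlying ind-topological monoid equipped with a topological group
action — i.e., in the terminology of [AbsTopIII], Definition 3.1, (ii), MLF-Galois TM-pair — of `G ↷ O^⊳(G)`
maps bijectively [i.e., by forgetting “`O^⊳(G)`”] onto the group of automorphisms of the topological group
`G`"): for MLF-Galois `TM`-pairs OF MONO-ANALYTIC TYPE — both
monoids carrying actions of (isomorphs of) `G_v(†Π_v)` itself, as printed — every identification `f` of
the groups carries exactly one `f`-equivariant isomorphism of monoids. Existence from the named statement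
`GaloisIsoLiftsToTMPairIsoOfMonoAnalytic` (abc-iut-L4-t2, FACT-LIST F-0410) BY NAME; uniqueness proved.
[cite: Mochizuki2012, Prop 4.2 (i) p.124] -/
theorem prop42i_of_monoAnalyticLifts (hlift : GaloisIsoLiftsToTMPairIsoOfMonoAnalytic)
    (hP : IsMLFGaloisMonoidPair .TM P) (hQ : IsMLFGaloisMonoidPair .TM Q)
    (hPm : IsOfMonoAnalyticTypeMonoid .TM P) (hQm : IsOfMonoAnalyticTypeMonoid .TM Q)
    (f : P.Pi ≃ₜ* Q.Pi) : Prop42i P Q f :=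
  prop42i_of_exists_lift hP hQ f (hlift P Q hP hQ hPm hQm f)

/-- **[IUTchII] Prop 4.2 (i) DISCHARGED in the shape of its second reference, [AbsTopIII] Prop 3.2 (iv)**
(as corrected by the author's Comments (2019) item (5): bijectivity for pairs of hyperbolic orbicurve
type): for MLF-Galois `TM`-pairs `(Π ↷ M)`, `(Π* ↷ M*)` satisfying the orbicurve-type predicate `H` and an
identification `f` respecting the arithmetic quotients (`G_v(†Π_v)` on both sides), exactly one
`f`-equivariant isomorphism of monoids. Existence from `GaloisIsoLiftsToTMPairIso H` (abc-iut-L4-t2,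
FACT-LIST F-0409, a schema: hypothesis at the consumer's instance `H`) BY NAME; uniqueness proved.
[cite: Mochizuki2012, Prop 4.2 (i) p.124] -/
theorem prop42i_of_galoisIsoLifts {H : GaloisMonoidPair.{0} → Prop} (hlift : GaloisIsoLiftsToTMPairIso H)
    (hP : IsMLFGaloisMonoidPair .TM P) (hQ : IsMLFGaloisMonoidPair .TM Q) (hHP : H P) (hHQ : H Q)
    (f : P.Pi ≃ₜ* Q.Pi) (hf : P.actionKer.map f.toMulEquiv.toMonoidHom = Q.actionKer) : Prop42i P Q f :=
  prop42i_of_exists_lift hP hQ f (hlift P Q hP hQ hHP hHQ f hf)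

/-- The literal printed shape of (i) — ONE identification `f` of the acting groups (`G_v(†Π_v)` on both
sides, `f` "the identity") and two monoids `M = Ψ_{†F_v}`, `M* = Ψ_cns(†Π_v)`: `Prop42i` unfolds to "there
exists a unique `f`-equivariant isomorphism of monoids `M ⥲ M*`". [cite: Mochizuki2012, Prop 4.2 (i) p.124] -/
theorem prop42i_iff (P Q : GaloisMonoidPair.{u}) (f : P.Pi ≃ₜ* Q.Pi) :
    Prop42i P Q f ↔ ∃! φ : P.M ≃* Q.M, ∀ (g : P.Pi) (m : P.M), φ (g • m) = f g • φ m := Iff.rfl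

end ConstantMonoids

/-! ### 3. Prop 4.2 (ii), unit part: a unique `Ẑ^×`-orbit of equivariant isomorphisms of `TCG`-pairs -/

section UnitPart

variable {P Q : GaloisMonoidPair.{0}}

/-- The isomorphism of cyclotomes `μ_Ẑ(M) ⥲ μ_Ẑ(M*)` induced by an isomorphism of groups `φ : M ⥲ M*` — the
component along which [AbsTopIII] Prop 3.3 (ii) measures the `Ẑ^×`-indeterminacy (abc-iut-L4-t2's
`UnitPairIsoFibres`, written there pointwise as `cyclotome.map (Units.map φ)`).
[cite: MochizukiAbsTopIII2015, Proposition 3.3 (ii) p.74] -/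
def cyclotomeMapOf (φ : P.M ≃* Q.M) : cyclotome P.M →* cyclotome Q.M :=
  Literature.AnabelianGeometry.EtaleTheta.cyclotome.map (Units.map φ.toMonoidHom)

/-- **Uniqueness within a `Ẑ^×`-orbit, PROVED** ([IUTchII] Prop 4.2 (ii) p. 124 via [AbsTopIII] Prop 3.3
(ii), determination half = abc-iut-L6-t21/L4's `unitPairIso_isoM_eq`): two `f`-equivariant isomorphisms of
MLF-Galois `TCG`-pairs inducing the same map on cyclotomes coincide.
[cite: Mochizuki2012, Prop 4.2 (ii) p.124] -/
theorem equivariantIsoOver_eq_of_cyclotome_eq (hP : IsMLFGaloisMonoidPair .TCG P)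
    (hQ : IsMLFGaloisMonoidPair .TCG Q) (f : P.Pi ≃ₜ* Q.Pi) {φ₁ φ₂ : P.M ≃* Q.M}
    (h₁ : φ₁ ∈ equivariantIsoOver P Q f) (h₂ : φ₂ ∈ equivariantIsoOver P Q f)
    (hcyc : ∀ ζ, cyclotomeMapOf φ₁ ζ = cyclotomeMapOf φ₂ ζ) : φ₁ = φ₂ :=
  unitPairIso_isoM_eq .TCG P Q (Or.inr rfl) hP hQ (isoOfEquivariant f φ₁ h₁) (isoOfEquivariant f φ₂ h₂)
    rfl hcyc

/-- **REAL STATEMENT of the unit part of [IUTchII] Prop 4.2 (ii)** (p. 124: "There exists a unique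
`†G_v`-equivariant `Ẑ^×`-orbit of isomorphisms of topological groups `Ψ^×_{†F^⊢_v} ⥲ Ψ_cns(†G_v)^×` — cf. Remark
1.11.1, (i), (b); [AbsTopIII], Proposition 3.3, (ii)") for the `TCG`-pairs `P = (†G_v ↷ Ψ^×_{†F^⊢_v})`,
`Q = (†G_v ↷ Ψ_cns(†G_v)^×)` and the identification `f` of the groups, in abc-iut-L4-t2's encoding of the
`Ẑ^×`-indeterminacy by the cyclotome component (`Aut(μ_Ẑ) = Ẑ^×`): the `f`-equivariant group isomorphisms
form ONE torsor under the automorphisms of the cyclotome — for every isomorphism of cyclotomes `u` there is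
exactly one `f`-equivariant isomorphism inducing `u`. The slot it makes real:
`Prop42Statements.unitOrbit` (p404158). [cite: Mochizuki2012, Prop 4.2 (ii) p.124] -/
def Prop42iiUnit (P Q : GaloisMonoidPair.{0}) (f : P.Pi ≃ₜ* Q.Pi) : Prop :=
  ∀ u : cyclotome P.M ≃* cyclotome Q.M,
    ∃! φ : P.M ≃* Q.M, φ ∈ equivariantIsoOver P Q f ∧ ∀ ζ, cyclotomeMapOf φ ζ = u ζ

/-- **The `Ẑ^×`-orbit is full, PROVED** ([IUTchII] Prop 4.2 (ii) p. 124; [AbsTopIII] Prop 3.3 (ii) "a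
bijection if `T = TCG`" in the author's corrected form): between MLF-Galois `TCG`-pairs, ONE `f`-equivariant
isomorphism of groups already yields the whole torsor — every isomorphism of cyclotomes `u` is induced by
exactly one `f`-equivariant isomorphism (fullness from abc-iut-L6-d1's `GaloisMonoidPair.Iso.tcg_exists_realising`,
uniqueness from `equivariantIsoOver_eq_of_cyclotome_eq`). So the printed "unique `Ẑ^×`-orbit" REDUCES to the
existence of a single equivariant isomorphism. [cite: Mochizuki2012, Prop 4.2 (ii) p.124] -/
theorem prop42iiUnit_of_exists (hP : IsMLFGaloisMonoidPair .TCG P) (hQ : IsMLFGaloisMonoidPair .TCG Q)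
    (f : P.Pi ≃ₜ* Q.Pi) (h : ∃ φ : P.M ≃* Q.M, φ ∈ equivariantIsoOver P Q f) : Prop42iiUnit P Q f := by
  obtain ⟨φ₀, hφ₀⟩ := h
  intro u
  obtain ⟨e, he, hu⟩ := GaloisMonoidPair.Iso.tcg_exists_realising hP (isoOfEquivariant f φ₀ hφ₀) u
  change e.isoPi = f at he
  subst he
  refine ⟨e.isoM, ⟨isoM_mem_equivariantIsoOver e, hu⟩, fun φ hφ => ?_⟩
  exact equivariantIsoOver_eq_of_cyclotome_eq hP hQ e.isoPi hφ.1 (isoM_mem_equivariantIsoOver e)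
    (fun ζ => (hφ.2 ζ).trans (hu ζ).symm)

/-- **[IUTchII] Prop 4.2 (ii), unit part, DISCHARGED in the shape of Rmk 1.11.1 (i)(b)** (p. 50: the group
of automorphisms of the pair `G ↷ O^×(G)` "maps surjectively [i.e., by forgetting “`O^×(G)`”] onto the group of
automorphisms of the topological group `G`, with kernel given by the [`G`-linear] automorphisms of [the
underlying ind-topological module of] `O^×(G)` determined by the natural action of `Ẑ^×`"): for MLF-Galois `TCG`-pairs of
mono-analytic type, `Prop42iiUnit` holds over every identification `f` — the existence of one lift from
`TCGPairIsoLiftsOfMonoAnalytic` (abc-iut-L4-t2, FACT-LIST F-0411) BY NAME, torsor structure proved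
(`prop42iiUnit_of_exists`). [cite: Mochizuki2012, Prop 4.2 (ii) p.124] -/
theorem prop42iiUnit_of_tcgLifts (hlift : TCGPairIsoLiftsOfMonoAnalytic)
    (hP : IsMLFGaloisMonoidPair .TCG P) (hQ : IsMLFGaloisMonoidPair .TCG Q)
    (hPm : IsOfMonoAnalyticTypeMonoid .TCG P) (hQm : IsOfMonoAnalyticTypeMonoid .TCG Q)
    (f : P.Pi ≃ₜ* Q.Pi) : Prop42iiUnit P Q f := by
  intro u
  obtain ⟨e, he, -⟩ := hlift P Q hP hQ hPm hQm f u
  subst he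
  exact prop42iiUnit_of_exists hP hQ e.isoPi ⟨e.isoM, isoM_mem_equivariantIsoOver e⟩ u

end UnitPart

end GoodPrimeKummer

end Literature.IUT.HodgeArakelov
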